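import Summits.AtomisticToContinuum.BoseEinsteinCondensation.Theses.BECGroundStateSOS
import Literature.MathematicalPhysics.QuantumLattice.XYOrderGDProofs
import Literature.MathematicalPhysics.QuantumLattice.LiebMattisMatrixElements
import Literature.MathematicalPhysics.QuantumLattice.LatticeToriLROProofs
import Literature.Probability.LatticeModels.GaussianDomination
import Literature.MathematicalPhysics.QuantumLattice.Z2GaugeHiggsTorus

/-!
# Crux `LatticeODLROOffHalfFilling` — the saturation SOS certificate for `H_{L,μ}`

Crux-disprover support file for `stmt-AtomisticToContinuum-11033` (route BECGroundStateSOS),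
part 1 of 2 (part 2: `SaturationNoLRO.lean`). Spin-½ site algebra (`S⁺_x`, `P↓_x`, the XY bond
operator `hop x y = S¹_xS¹_y + S²_xS²_y` and its two sum-of-squares forms `hop_eq_sub`,
`hop_eq_add`), the crux Hamiltonian `Hmu L μ = xxzHamiltonian 1 (torusGraph 3 L) (-1) 0 − μ •
totalSpin 1 2` on the torus `(ℤ/Lℤ)³`, and the certificate
`hmu_decomp : H_{L,μ} = −(μ|Λ|/2)·1 + (μ−3)·N↓ + ½ Σ_x Σ_i (S⁺_x − S⁺_{x+eᵢ})ᴴ(S⁺_x − S⁺_{x+eᵢ})`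
(`L ≥ 3`), with the all-up eigenvector (`hmu_mulVec_upVec`) and `E₀ ≤ −μ|Λ|/2`
(`groundEnergy_hmu_le`). All [folklore].
-/

noncomputable section

namespace Summit.AtomisticToContinuum.BoseEinsteinCondensation.Theorems.LatticeODLROOffHalfFilling.Negative

open Literature.MathematicalPhysics.QuantumLattice Literature.Probability.LatticeModels Matrix Finset
open scoped ComplexOrder BigOperators

/-! ### Spin-½ single-site algebra: `S⁺ = |↑⟩⟨↓|`, `P↓ = |↓⟩⟨↓|` -/

section SingleSite

/-- The spin-½ raising matrix `e = |↑⟩⟨↓|` (basis `0 = ↑`, `1 = ↓`). [folklore] -/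
def raise : Matrix (Fin 2) (Fin 2) ℂ := !![0, 1; 0, 0]

/-- The projection `P↓ = |↓⟩⟨↓|` onto the down state. [folklore] -/
def pDown : Matrix (Fin 2) (Fin 2) ℂ := !![0, 0; 0, 1]

/-- `S⁻S⁺ = P↓` for spin ½. [folklore] -/
theorem raise_conjTranspose_mul_raise : raiseᴴ * raise = pDown := by
  ext i j
  fin_cases i <;> fin_cases j <;> simp [raise, pDown, Matrix.mul_apply, conjTranspose_apply]

/-- `σˣ = e + eᴴ`. [folklore] -/
theorem spinHalfPauli_zero_eq : spinHalfPauli 0 = raise + raiseᴴ := by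
  ext i j
  fin_cases i <;> fin_cases j <;> simp [raise, spinHalfPauli, conjTranspose_apply]

/-- `σʸ = i(eᴴ − e)`. [folklore] -/
theorem spinHalfPauli_one_eq : spinHalfPauli 1 = Complex.I • (raiseᴴ - raise) := by
  ext i j
  fin_cases i <;> fin_cases j <;> simp [raise, spinHalfPauli, conjTranspose_apply]

/-- `σᶻ = 1 − 2P↓`. [folklore] -/
theorem spinHalfPauli_two_eq : spinHalfPauli 2 = 1 - (2 : ℂ) • pDown := by
  ext i j
  fin_cases i <;> fin_cases j <;> simp [pDown, spinHalfPauli]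
  norm_num

/-- `(S^α)² = ¼` for spin ½. [folklore] -/
theorem spinVec_one_mul_self (α : Fin 3) :
    spinVec 1 α * spinVec 1 α = (1 / 4 : ℂ) • (1 : Matrix (Fin 2) (Fin 2) ℂ) := by
  rw [spinVec_one_eq_half_spinHalfPauli, smul_mul_smul_comm, Z2GaugeHiggs.spinHalfPauli_mul_self]
  norm_num

end SingleSite

/-! ### Site operators on a finite lattice -/

section Sites

variable {Λ : Type*} [Fintype Λ] [DecidableEq Λ]

/-- `S⁺_x`. [folklore] -/
def E (x : Λ) : Op Λ 2 := onSite x raise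

/-- `P↓_x = S⁻_x S⁺_x` (number of down spins at `x`). [folklore] -/
def Pd (x : Λ) : Op Λ 2 := onSite x pDown

/-- The XY bond (hopping) operator `S¹_x S¹_y + S²_x S²_y`, exactly the summand of the crux's
order parameter. [folklore] -/
def hop (x y : Λ) : Op Λ 2 := siteSpin 1 x 0 * siteSpin 1 y 0 + siteSpin 1 x 1 * siteSpin 1 y 1

/-- `(S⁺_x)ᴴ = S⁻_x`. [folklore] -/
theorem E_conjTranspose (x : Λ) : (E x)ᴴ = onSite x raiseᴴ := by
  rw [E, onSite_conjTranspose]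

/-- `S¹_x = ½(S⁺_x + S⁻_x)`. [folklore] -/
theorem siteSpin_zero_eq (x : Λ) : siteSpin 1 x 0 = (1 / 2 : ℂ) • (E x + (E x)ᴴ) := by
  rw [siteSpin, spinVec_one_eq_half_spinHalfPauli, spinHalfPauli_zero_eq, onSite_smul',
    onSite_add', E_conjTranspose, E]

/-- `S²_x = (i/2)(S⁻_x − S⁺_x)`. [folklore] -/
theorem siteSpin_one_eq (x : Λ) :
    siteSpin 1 x 1 = ((1 / 2 : ℂ) * Complex.I) • ((E x)ᴴ - E x) := by
  rw [siteSpin, spinVec_one_eq_half_spinHalfPauli, spinHalfPauli_one_eq, onSite_smul',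
    onSite_smul', onSite_sub', E_conjTranspose, E, smul_smul]

/-- `S³_x = ½ − P↓_x`. [folklore] -/
theorem siteSpin_two_eq (x : Λ) : siteSpin 1 x 2 = (1 / 2 : ℂ) • 1 - Pd x := by
  rw [siteSpin, spinVec_one_eq_half_spinHalfPauli, spinHalfPauli_two_eq, onSite_smul',
    onSite_sub', onSite_one', onSite_smul', Pd, smul_sub, smul_smul]
  norm_num

/-- `S⁻_xS⁺_x = P↓_x`. [folklore] -/
theorem E_conjTranspose_mul_E (x : Λ) : (E x)ᴴ * E x = Pd x := by
  rw [E_conjTranspose, E, onSite_mul, raise_conjTranspose_mul_raise, Pd]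

/-- `(S^α_x)² = ¼` for spin ½. [folklore] -/
theorem siteSpin_mul_self (x : Λ) (α : Fin 3) :
    siteSpin 1 x α * siteSpin 1 x α = (1 / 4 : ℂ) • (1 : Op Λ 2) := by
  rw [siteSpin, onSite_mul, spinVec_one_mul_self, onSite_smul', onSite_one']

/-- `S¹_xS¹_y + S²_xS²_y = ½(S⁺_xS⁻_y + S⁻_xS⁺_y)` (any ring). [folklore] -/
theorem hop_eq (x y : Λ) : hop x y = (1 / 2 : ℂ) • (E x * (E y)ᴴ + (E x)ᴴ * E y) := by
  rw [hop, siteSpin_zero_eq, siteSpin_zero_eq, siteSpin_one_eq, siteSpin_one_eq]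
  have hI : (1 / 2 : ℂ) * Complex.I * ((1 / 2 : ℂ) * Complex.I) = -(1 / 4 : ℂ) := by
    ring_nf
    rw [Complex.I_sq]
    ring
  rw [smul_mul_smul_comm, smul_mul_smul_comm, hI]
  simp only [add_mul, mul_add, sub_mul, mul_sub, smul_add, smul_sub]
  module

/-- SOS identity 1: `hop = ½(P↓_x + P↓_y) − ½ (S⁺_x − S⁺_y)ᴴ(S⁺_x − S⁺_y)` for `x ≠ y`. [folklore] -/
theorem hop_eq_sub {x y : Λ} (hxy : x ≠ y) :
    hop x y = (1 / 2 : ℂ) • (Pd x + Pd y) - (1 / 2 : ℂ) • ((E x - E y)ᴴ * (E x - E y)) := by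
  have hcomm : E x * (E y)ᴴ = (E y)ᴴ * E x := by
    rw [E_conjTranspose, E, onSite_mul_onSite_comm hxy]
  rw [hop_eq, conjTranspose_sub, sub_mul, mul_sub, mul_sub, E_conjTranspose_mul_E,
    E_conjTranspose_mul_E, hcomm]
  module

/-- SOS identity 2: `hop = ½ (S⁺_x + S⁺_y)ᴴ(S⁺_x + S⁺_y) − ½(P↓_x + P↓_y)` for `x ≠ y`. [folklore] -/
theorem hop_eq_add {x y : Λ} (hxy : x ≠ y) :
    hop x y = (1 / 2 : ℂ) • ((E x + E y)ᴴ * (E x + E y)) - (1 / 2 : ℂ) • (Pd x + Pd y) := by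
  have hcomm : E x * (E y)ᴴ = (E y)ᴴ * E x := by
    rw [E_conjTranspose, E, onSite_mul_onSite_comm hxy]
  rw [hop_eq, conjTranspose_add, add_mul, mul_add, mul_add, E_conjTranspose_mul_E,
    E_conjTranspose_mul_E, hcomm]
  module


/-- `S³_tot = |Λ|/2 − N↓` for spin ½. [folklore] -/
theorem totalSpin_two_eq :
    (totalSpin 1 2 : Op Λ 2) = ((Fintype.card Λ : ℂ) / 2) • 1 - ∑ x : Λ, Pd x := by
  unfold totalSpin
  simp only [siteSpin_two_eq, Finset.sum_sub_distrib, Finset.sum_const, Finset.card_univ]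
  rw [← Nat.cast_smul_eq_nsmul ℂ, smul_smul]
  congr 1
  ring

/-- The all-up (fully polarised, empty-of-bosons) basis vector. [folklore] -/
def upVec : TensorIndex Λ 2 → ℂ := Pi.single (fun _ => (0 : Fin 2)) 1

/-- The all-up vector vanishes on any configuration with a down spin at `x`. [folklore] -/
theorem upVec_update_one (σ : TensorIndex Λ 2) (x : Λ) :
    (upVec : TensorIndex Λ 2 → ℂ) (Function.update σ x 1) = 0 := by
  rw [upVec, Pi.single_apply, if_neg]
  intro h
  have := congr_fun h x
  simp at this

/-- `S⁺_x |⇑⟩ = 0`. [folklore] -/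
theorem E_mulVec_upVec (x : Λ) : E x *ᵥ (upVec : TensorIndex Λ 2 → ℂ) = 0 := by
  ext σ
  rw [E, LiebMattis.onSite_mulVec_apply, Fin.sum_univ_two, Pi.zero_apply, upVec_update_one, mul_zero,
    add_zero]
  have h0 : ∀ k : Fin 2, raise k 0 = 0 := by
    intro k; fin_cases k <;> simp [raise]
  rw [h0, zero_mul]

/-- `P↓_x |⇑⟩ = 0`. [folklore] -/
theorem Pd_mulVec_upVec (x : Λ) : Pd x *ᵥ (upVec : TensorIndex Λ 2 → ℂ) = 0 := by
  ext σ
  rw [Pd, LiebMattis.onSite_mulVec_apply, Fin.sum_univ_two, Pi.zero_apply, upVec_update_one, mul_zero,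
    add_zero]
  have h0 : ∀ k : Fin 2, pDown k 0 = 0 := by
    intro k; fin_cases k <;> simp [pDown]
  rw [h0, zero_mul]

/-- `⟨⇑|⇑⟩ = 1`. [folklore] -/
theorem star_upVec_dotProduct_upVec :
    star (upVec : TensorIndex Λ 2 → ℂ) ⬝ᵥ upVec = 1 := by
  simp [upVec]

end Sites

/-! ### The crux Hamiltonian on the torus `(ℤ/Lℤ)³` above the saturation field `μ > 3` -/

section Torus

variable (L : ℕ) [NeZero L]

/-- The crux's Hamiltonian `H_{L,μ} = −Σ_{⟨xy⟩}(S¹_xS¹_y + S²_xS²_y) − μ S³_tot` (verbatim the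
matrix fed to `groundStateFunctional` in `LatticeODLROOffHalfFilling`). [folklore] -/
abbrev Hmu (μ : ℝ) : Op (TorusSite 3 L) 2 :=
  xxzHamiltonian 1 (torusGraph 3 L) (-1) 0 - (μ : ℂ) • totalSpin 1 2

/-- `H_{L,μ}` is Hermitian (real `μ`). [folklore] -/
theorem Hmu_isHermitian (μ : ℝ) : (Hmu L μ).IsHermitian :=
  (xxzHamiltonian_isHermitian 1 _ (-1) 0).sub ((totalSpin_isHermitian 1 2).ofReal_smul μ)

/-- Unfolding the edge sum of `xxzHamiltonian` on the torus of side `L ≥ 3` into the sum over the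
`3|Λ|` directed bonds `(x, x + eᵢ)` (`sum_edgeFinset_torusGraph`). [folklore] -/
theorem xxz_eq_sum_bonds (hL : 3 ≤ L) :
    xxzHamiltonian 1 (torusGraph 3 L) (-1) 0 =
      ((-1 : ℝ) : ℂ) • ∑ x : TorusSite 3 L, ∑ i : Fin 3,
        (spinBond 1 0 x (x + Pi.single i 1) + spinBond 1 1 x (x + Pi.single i 1) +
          ((0 : ℝ) : ℂ) • spinBond 1 2 x (x + Pi.single i 1)) := by
  unfold xxzHamiltonian
  rw [sum_edgeFinset_torusGraph hL]
  rfl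

/-- On the torus of side `L ≥ 3` the XY Hamiltonian is minus the sum of the hopping operators over
the `3|Λ|` directed bonds `(x, x + eᵢ)`. [folklore] -/
theorem xxz_eq (hL : 3 ≤ L) :
    xxzHamiltonian 1 (torusGraph 3 L) (-1) 0 =
      -∑ x : TorusSite 3 L, ∑ i : Fin 3, hop x (x + Pi.single i 1) := by
  have hL2 : 2 ≤ L := by omega
  rw [xxz_eq_sum_bonds L hL, Complex.ofReal_neg, Complex.ofReal_one, neg_smul, one_smul, neg_inj]
  refine Finset.sum_congr rfl fun x _ => Finset.sum_congr rfl fun i _ => ?_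
  have hne : x ≠ x + Pi.single i 1 := fun h =>
    torus_single_ne_zero hL2 i (left_eq_add.mp h)
  rw [spinBond_eq_mul_of_ne hne, spinBond_eq_mul_of_ne hne, Complex.ofReal_zero, zero_smul,
    add_zero, hop]

/-- **The saturation SOS certificate.** For `L ≥ 3`:
`H_{L,μ} = −(μ|Λ|/2)·1 + (μ − 3)·N↓ + ½ Σ_x Σ_i (S⁺_x − S⁺_{x+eᵢ})ᴴ(S⁺_x − S⁺_{x+eᵢ})`.
For `μ > 3` every term after the constant is a positive multiple of a square. [folklore] -/
theorem hmu_decomp (hL : 3 ≤ L) (μ : ℝ) :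
    Hmu L μ = ((-(μ * Fintype.card (TorusSite 3 L) / 2) : ℝ) : ℂ) • (1 : Op (TorusSite 3 L) 2)
      + ((μ - 3 : ℝ) : ℂ) • (∑ x : TorusSite 3 L, Pd x)
      + ((1 / 2 : ℝ) : ℂ) • ∑ x : TorusSite 3 L, ∑ i : Fin 3,
          (E x - E (x + Pi.single i 1))ᴴ * (E x - E (x + Pi.single i 1)) := by
  have hL2 : 2 ≤ L := by omega
  have hhop : ∀ (x : TorusSite 3 L) (i : Fin 3), hop x (x + Pi.single i 1) =
      (1 / 2 : ℂ) • Pd x + (1 / 2 : ℂ) • Pd (x + Pi.single i 1) -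
        (1 / 2 : ℂ) • ((E x - E (x + Pi.single i 1))ᴴ * (E x - E (x + Pi.single i 1))) := by
    intro x i
    have hne : x ≠ x + Pi.single i 1 := fun h =>
      torus_single_ne_zero hL2 i (left_eq_add.mp h)
    rw [hop_eq_sub hne, smul_add]
  have hshift : ∀ i : Fin 3,
      ∑ x : TorusSite 3 L, (1 / 2 : ℂ) • Pd (x + Pi.single i 1) =
        ∑ x : TorusSite 3 L, (1 / 2 : ℂ) • Pd x := fun i =>
    Equiv.sum_comp (Equiv.addRight (Pi.single i 1)) (fun x => (1 / 2 : ℂ) • Pd x)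
  have h2 : ∑ x : TorusSite 3 L, ∑ i : Fin 3, (1 / 2 : ℂ) • Pd (x + Pi.single i 1) =
      ∑ x : TorusSite 3 L, ∑ _i : Fin 3, (1 / 2 : ℂ) • Pd x := by
    rw [Finset.sum_comm]
    simp only [hshift]
    rw [Finset.sum_comm]
  rw [Hmu, xxz_eq L hL, totalSpin_two_eq]
  simp only [hhop, Finset.sum_sub_distrib, Finset.sum_add_distrib]
  rw [h2]
  simp only [Finset.sum_const, Finset.card_univ, Fintype.card_fin, ← Finset.smul_sum]
  push_cast
  module

/-- The all-up vector is an eigenvector of `H_{L,μ}` with eigenvalue `−μ|Λ|/2`. [folklore] -/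
theorem hmu_mulVec_upVec (hL : 3 ≤ L) (μ : ℝ) :
    Hmu L μ *ᵥ upVec = ((-(μ * Fintype.card (TorusSite 3 L) / 2) : ℝ) : ℂ) • upVec := by
  rw [hmu_decomp L hL μ, add_mulVec, add_mulVec, smul_mulVec, smul_mulVec,
    smul_mulVec, one_mulVec, Matrix.sum_mulVec, Matrix.sum_mulVec]
  simp only [Matrix.sum_mulVec, ← mulVec_mulVec, sub_mulVec, E_mulVec_upVec, Pd_mulVec_upVec,
    sub_zero, mulVec_zero, Finset.sum_const_zero, smul_zero, add_zero]

/-- Variational bound: `E₀(H_{L,μ}) ≤ −μ|Λ|/2`. [folklore] -/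
theorem groundEnergy_hmu_le (hL : 3 ≤ L) (μ : ℝ) :
    (Hmu L μ).groundEnergy ≤ -(μ * Fintype.card (TorusSite 3 L) / 2) := by
  have h := groundEnergy_le_rayleigh_holds (Hmu_isHermitian L μ) upVec
    star_upVec_dotProduct_upVec
  rwa [hmu_mulVec_upVec L hL μ, dotProduct_smul, star_upVec_dotProduct_upVec, smul_eq_mul,
    mul_one, Complex.ofReal_re] at h

end Torus

end Summit.AtomisticToContinuum.BoseEinsteinCondensation.Theorems.LatticeODLROOffHalfFilling.Negative
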